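import Literature.Probability.LatticeModels.SourcedDoubleCurrentsSwitching
import HarnessLib

/-!
# Switching a connection observable between the sourceless and the doubly-sourced box current
(route ArmHyperscaling, crux `MergingFloor`, item stmt-CriticalPhenomena-15592, line `xor-cluster-sign-bk`)

For the free box `Λ_L ⊂ ℤ^d`, `β ≥ 0`, a finite `S ⊆ Λ_L` and `a, b ∈ Λ_L`:

  `P^{∅,∅}_{Λ_L,β}[(a ↔ b) ∧ 𝓕_S] = (⟨σ_S⟩⁰_{Λ_L})² · P^{S,S}_{Λ_L,β}[a ↔ b]`

— Aizenman–Duminil-Copin's switching lemma (Ann. of Math. 194 (2021), Lemma 3.3: for every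
bounded `F` of the SUM of the two currents, `∑_{∂n₁=A,∂n₂=B} w w F(n₁+n₂) =
∑_{∂n₁=A∆B,∂n₂=∅} w w F(n₁+n₂) 𝟙[n₁+n₂ ∈ 𝓕_B]`) on the free box graph with `A = B = S` and the
observable `F = 𝟙[a ↔ b in n₁+n₂]`, read on the lifted trace.  With `F = 1` this is the box XOR /
cluster-sign identity `P^{∅,∅}[𝓕_S] = ⟨σ_S⟩²` (ADC21 (3.7) with `A = B = S`,
`isingCorr_free_box_mul_eq`); here the connection event rides along.  It recasts the heart (SD) of the
line (a ceiling on `P^{∅,∅}[(y₀↔y₁)∧𝓕_S]`) as SOURCE DOUBLING: `⟨σ_S⟩² P^{S,S}[y₀↔y₁] ≤ (3−2c)·u·w`.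

References: M. Aizenman, H. Duminil-Copin, Ann. of Math. 194 (2021), Lemma 3.3 and (3.7) (tree:
`currentSum_switching_subcurrent`, `doubleCurrentMeasure_real_mul'`). No definitions, no named facts.
-/

noncomputable section

namespace Summit.CriticalPhenomena.Ising3DConformalLimit.ArmHyperscalingMergingFloorXor

open Literature.Probability.LatticeModels Literature.Probability.Percolation MeasureTheory Finset
open scoped symmDiff

section Core

variable {V : Type*} [Fintype V] [DecidableEq V] (G : SimpleGraph V) [DecidableRel G.Adj]

/-- **Switching a connection observable, current-sum form** (finite graph, `β ≥ 0`):
`P^{∅,∅}_{G,β}[(x ↔ y) ∧ 𝓕_A] · Z[∅]² = P^{A,A}_{G,β}[x ↔ y] · Z[A]²` — ADC21's Lemma 3.3 with the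
bounded observable `𝟙[x ↔ y in n₁ + n₂]` and `A = B`.
[cite: AizenmanDuminilCopinAnnals2021, Lemma 3.3] -/
theorem doubleCurrentMeasure_real_tracedConn_inter_subcurrent_mul {β : ℝ} (hβ : 0 ≤ β)
    (A : Finset V) (x y : V) :
    (doubleCurrentMeasure G β ∅ ∅).real (tracedConn G x y ∩ subcurrentEvent G A) *
        (currentSum G β ∅ * currentSum G β ∅) =
      (doubleCurrentMeasure G β A A).real (tracedConn G x y) * (currentSum G β A * currentSum G β A) := by
  classical
  -- the observable `F = 𝟙[x ↔ y]` of the sum current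
  obtain ⟨F, hFdef⟩ : ∃ F : Current G → ℝ,
      F = fun m => if (openGraph m.traced).Reachable x y then 1 else 0 := ⟨_, rfl⟩
  have hFb : ∃ C, ∀ n, ‖F n‖ ≤ C := ⟨1, fun n => by simp only [hFdef]; split_ifs <;> simp⟩
  have hFind : ∀ p : Current G × Current G,
      F (p.1 + p.2) = (tracedConn G x y).indicator (1 : Current G × Current G → ℝ) p := fun p => by
    simp only [hFdef, Set.indicator_apply, mem_tracedConn_iff, Pi.one_apply]
  have hsw := currentSum_switching_subcurrent G β A A F hFb
  rw [symmDiff_self, Finset.bot_eq_empty] at hsw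
  rw [doubleCurrentMeasure_real_mul' G hβ A A (measurableSet_tracedConn G x y),
    doubleCurrentMeasure_real_mul' G hβ ∅ ∅
      ((measurableSet_tracedConn G x y).inter (measurableSet_subcurrentEvent G A))]
  have hprod : ∀ p : Current G × Current G,
      (tracedConn G x y ∩ subcurrentEvent G A).indicator (1 : Current G × Current G → ℝ) p =
        F (p.1 + p.2) * (subcurrentEvent G A).indicator 1 p := fun p => by
    rw [hFind]
    simp only [Set.indicator_apply, Set.mem_inter_iff, Pi.one_apply]
    split_ifs <;> simp_all
  simp_rw [hprod, ← mul_assoc, ← hsw, hFind]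

/-- **Switching a connection observable, normalised form** (finite graph, `β ≥ 0`):
`P^{∅,∅}_{G,β}[(x ↔ y) ∧ 𝓕_A] = (⟨σ_A⟩⁰_G)² · P^{A,A}_{G,β}[x ↔ y]` (`⟨σ_A⟩ = Z[A]/Z[∅]`).
[cite: AizenmanDuminilCopinAnnals2021, Lemma 3.3] -/
theorem doubleCurrentMeasure_real_tracedConn_inter_subcurrent_eq {β : ℝ} (hβ : 0 ≤ β)
    (A : Finset V) (x y : V) :
    (doubleCurrentMeasure G β ∅ ∅).real (tracedConn G x y ∩ subcurrentEvent G A) =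
      isingCorr G univ β 0 .free A ^ 2 * (doubleCurrentMeasure G β A A).real (tracedConn G x y) := by
  have hZ0 : currentSum G β ∅ ≠ 0 := (currentSum_empty_pos' G β).ne'
  have h := doubleCurrentMeasure_real_tracedConn_inter_subcurrent_mul G hβ A x y
  rw [isingCorr_free_eq_currentSum_div_holds G β A, div_pow, sq, sq]
  field_simp
  linear_combination h

end Core

/-- **Switching a connection observable in the box** (free box `Λ_L ⊂ ℤ^d`, `β ≥ 0`, `S ⊆ Λ_L`,
`a, b ∈ Λ_L`): `P^{∅,∅}_{Λ_L,β}[(a ↔ b) ∧ 𝓕_S] = (⟨σ_S⟩⁰_{Λ_L})² · P^{S,S}_{Λ_L,β}[a ↔ b]` — the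
finite-graph identity transported along the lifted trace (`sourcedDoubleCurrentLaw_apply`,
`sourcedTrace_preimage_openConn`, `sourcedTrace_preimage_traceSubcurrentEvent`,
`isingCorr_free_box_eq_boxGraph`). [cite: AizenmanDuminilCopinAnnals2021, Lemma 3.3] -/
theorem sourceless_real_openConn_inter_traceSubcurrentEvent_eq (d L : ℕ) {β : ℝ} (hβ : 0 ≤ β)
    {S : Finset (Site d)} (hS : S ⊆ box d L) {a b : Site d} (ha : a ∈ box d L) (hb : b ∈ box d L) :
    (sourcedDoubleCurrentLaw d L β ∅ ∅).real (openConn a b ∩ traceSubcurrentEvent S) =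
      isingCorr (zdGraph d) (box d L) β 0 .free S ^ 2 *
        (sourcedDoubleCurrentLaw d L β S S).real (openConn a b) := by
  obtain ⟨a, rfl⟩ : ∃ a' : BoxVertex d L, (a' : Site d) = a := ⟨⟨a, box_subset_box_succ d L ha⟩, rfl⟩
  obtain ⟨b, rfl⟩ : ∃ b' : BoxVertex d L, (b' : Site d) = b := ⟨⟨b, box_subset_box_succ d L hb⟩, rfl⟩
  have hE : MeasurableSet (openConn (a : Site d) (b : Site d) : Set (BondConfig (Site d))) :=
    measurableSet_openConn_holds _ _
  have hEF : MeasurableSet (openConn (a : Site d) (b : Site d) ∩ traceSubcurrentEvent S :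
      Set (BondConfig (Site d))) := hE.inter (measurableSet_traceSubcurrentEvent S)
  rw [measureReal_def, sourcedDoubleCurrentLaw_apply L β ∅ ∅ hEF, boxSources_empty, Set.preimage_inter,
    sourcedTrace_preimage_openConn, sourcedTrace_preimage_traceSubcurrentEvent d (subset_box_succ_of_subset d hS),
    ← measureReal_def, measureReal_def (sourcedDoubleCurrentLaw d L β S S), sourcedDoubleCurrentLaw_apply L β S S hE,
    sourcedTrace_preimage_openConn, ← measureReal_def, isingCorr_free_box_eq_boxGraph d L β hS]
  exact doubleCurrentMeasure_real_tracedConn_inter_subcurrent_eq (freeBoxGraph d L) hβ (boxSources d L S) a b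

/-- **Registered stub `stub_switchObservable` of line `xor-cluster-sign-bk`** (skeleton v3): the box
identity `P^{∅,∅}_{Λ_L,β}[(a ↔ b) ∧ 𝓕_S] = (⟨σ_S⟩⁰_{Λ_L})² · P^{S,S}_{Λ_L,β}[a ↔ b]` for `β ≥ 0`,
`S ⊆ Λ_L`, `a, b ∈ Λ_L` (`sourceless_real_openConn_inter_traceSubcurrentEvent_eq`).
[cite: AizenmanDuminilCopinAnnals2021, Lemma 3.3] -/
theorem stub_switchObservable : ∀ (d L : ℕ) (β : ℝ), 0 ≤ β → ∀ (S : Finset (Site d)) (a b : Site d),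
    S ⊆ box d L → a ∈ box d L → b ∈ box d L →
    (sourcedDoubleCurrentLaw d L β ∅ ∅).real (openConn a b ∩ traceSubcurrentEvent S) =
      isingCorr (zdGraph d) (box d L) β 0 .free S ^ 2 * (sourcedDoubleCurrentLaw d L β S S).real (openConn a b) :=
  fun d L _β hβ _S _a _b hS ha hb => sourceless_real_openConn_inter_traceSubcurrentEvent_eq d L hβ hS ha hb

end Summit.CriticalPhenomena.Ising3DConformalLimit.ArmHyperscalingMergingFloorXor
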